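import Summits.BirchSwinnertonDyer.BirchSwinnertonDyer.Theorems.KolyvaginDepthDoorDepthTableKuriharaDecisiveTripleKit
import Literature.GroupTheory.FiniteAbelian.MaximalOrderSummand
import Literature.GroupTheory.FiniteAbelian.InvariantFactorsUnique
import Literature.GroupTheory.FiniteAbelian.PrimePowerTorsionCounts
import HarnessLib

/-!
# Route `KolyvaginDepthDoor`, crux `KolyvaginDepthSupplyKN` (stmt-BirchSwinnertonDyer-22820) —
# DEPTH TABLE v25, CERTIFICATE KIT: the cyclicity binder `#Ẽ(𝔽_ℓ)[p] ≤ p` from ONE WITNESS POINT `R` with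
# `(#Ẽ(𝔽_ℓ)/p) • R ≠ O` — for Kolyvagin primes `ℓ` with `p² ∣ #Ẽ(𝔽_ℓ)` and `Ẽ(𝔽_ℓ)` NOT cyclic

Helper file of the lead prover of line `levelone` (kdd-p1 g29; `--supports stmt-BirchSwinnertonDyer-22820
--as helper`); it closes nothing and BSD is NOT proved by it. Pure kernel plumbing (no named fact).

WHY. A row of the depth table needs its level `n` to be a CYCLIC Kolyvagin level: `#Ẽ(𝔽_ℓ)[p] ≤ p` at every
`ℓ ∣ n` (`IsCyclicKolyvaginLevel`). The tree certifies this by `card_torsion_le_of_intModel_of_card` when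
`p² ∤ #Ẽ(𝔽_ℓ)` and by g27's generator kit `card_torsion_le_of_intModel_of_generator` when `Ẽ(𝔽_ℓ)` is CYCLIC
(a generator with `(N/r) • R ≠ O` for EVERY prime `r ∣ N`). Neither covers a Kolyvagin prime with
`p² ∣ N = #Ẽ(𝔽_ℓ)` and `Ẽ(𝔽_ℓ) ≅ ℤ/a ⊕ ℤ/b` non-cyclic with cyclic `p`-part — e.g. `794a1` at `(p, ℓ) = (11, 463)`,
the level prime of the one supersingular record among the 18 rank-two curves `N < 1000`. Here ONE chain suffices:
a point `R` with `(N/p) • R ≠ O` shows that the exponent `e` of `Ẽ(𝔽_ℓ)` does not divide `N/p`, so `p ∤ N/e`;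
by Hungerford II §2 Ex. 2 (`G ≅ ℤ/e ⊕ H`, `#H = N/e`, tree `exists_addEquiv_zmod_exponent_prod`) the `p`-torsion is
`(ℤ/e)[p] ⊕ H[p]` with `#H[p] = #H[gcd(p, #H)] = 1`, hence `#G[p] = gcd(p, e) ≤ p`.

* `natCard_nsmul_eq_zero_le_of_witness` — the group-theory lemma (finite abelian `G`, prime `p`, `R ∈ G`
  with `(#G/p) • R ≠ 0` ⟹ `#{x : p • x = 0} ≤ p`);
* `card_torsion_le_of_witness` / `card_torsion_le_of_intModel_of_witness` — the elliptic reading on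
  `Ẽ(𝔽_ℓ)` of an integer model, the witness being a `decide`-checked addition chain
  (`Rank2Observatory.chainB`) from `R` to the multiplier `N/p` (same data format as the generator kit, one
  chain instead of one per prime factor of `N`).

References: [Hungerford1974] Ch. II §2 Exercise 2, Lemma 2.5; [SilvermanAEC2009] III.2.3; [Kim2022StructureSelmer] §1.2.2.
-/

set_option linter.dupNamespace false

noncomputable section

open scoped Classical

namespace Summit.BirchSwinnertonDyer.BirchSwinnertonDyer.Theorems.KolyvaginDepthDoor

open Literature.NumberTheory.EllipticCurves WeierstrassCurve
open Summit.BirchSwinnertonDyer.BirchSwinnertonDyer.Theorems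
open Summit.BirchSwinnertonDyer.BirchSwinnertonDyer.Rank2Observatory
open Literature.GroupTheory.FiniteAbelian

/-! ## §1 Group theory: one element not killed by `#G/p` forces `#G[p] ≤ p` -/

/-- **One witness forces a cyclic `p`-part.** `G` finite abelian, `p` prime, `R ∈ G` with `(#G/p) • R ≠ 0`
⟹ `#{x ∈ G : p • x = 0} ≤ p`. Proof: `G ≅ ℤ/e ⊕ H` with `e` the exponent (Hungerford II §2 Ex. 2),
`#G = e·#H`; if `p ∣ #H` then `#G/p = e·(#H/p)` kills everything — so `p ∤ #H`, `H[p] = H[gcd(p, #H)] = 0`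
and `#G[p] = #(ℤ/e)[p] = gcd(p, e) ≤ p`. [cite: Hungerford1974, Ch. II §2 Exercise 2 (PDF p. 141) with Lemma 2.5 (PDF p. 137)] -/
theorem natCard_nsmul_eq_zero_le_of_witness (G : Type*) [AddCommGroup G] [Finite G] {p : ℕ}
    (hp : p.Prime) (R : G) (hR : (Nat.card G / p) • R ≠ 0) :
    Nat.card {x : G // p • x = 0} ≤ p := by
  obtain ⟨H, ⟨e⟩⟩ := exists_addEquiv_zmod_exponent_prod G
  haveI : NeZero (AddMonoid.exponent G) := ⟨AddMonoid.exponent_ne_zero_of_finite⟩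
  -- `#G = e · #H`
  have hcard : Nat.card G = AddMonoid.exponent G * Nat.card H := by
    rw [Nat.card_congr e.toEquiv, Nat.card_prod, Nat.card_zmod]
  -- `p ∤ #H`
  have hpH : ¬ p ∣ Nat.card H := by
    rintro ⟨m, hm⟩
    apply hR
    have hq : Nat.card G / p = m * AddMonoid.exponent G := by
      rw [hcard, hm, ← mul_assoc, mul_comm (AddMonoid.exponent G) p, mul_assoc,
        Nat.mul_div_cancel_left _ hp.pos, mul_comm]
    rw [hq, mul_nsmul, AddMonoid.exponent_nsmul_eq_zero]
  -- count the `p`-torsion through `G ≅ ℤ/e ⊕ H`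
  have hH1 : Nat.card {b : H // p • b = 0} = 1 := by
    have hg : Nat.gcd p (Nat.card H) = 1 := (Nat.Prime.coprime_iff_not_dvd hp).mpr hpH
    rw [natCard_nsmul_eq_zero_eq_of_gcd_card H p, hg]
    refine Nat.card_eq_one_iff_unique.mpr ⟨⟨fun a b ↦ Subtype.ext ?_⟩, ⟨⟨0, by rw [one_nsmul]⟩⟩⟩
    have ha := a.2; have hb := b.2
    rw [one_nsmul] at ha hb
    rw [ha, hb]
  rw [natCard_nsmul_eq_zero_congr e p, natCard_nsmul_eq_zero_prod, natCard_nsmul_eq_zero_zmod, hH1, mul_one]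
  exact Nat.gcd_le_left _ hp.pos

/-! ## §2 The elliptic reading: `#Ẽ(𝔽_ℓ)[p] ≤ p` from one chain -/

section Witness

variable (V : WeierstrassCurve ℤ) (q : ℕ) [Fact q.Prime]

/-- **`#Ẽ(𝔽_q)[p] ≤ p` from ONE witness chain.** `q ∤ Δ(V)`; `#Ẽ(𝔽_q) = N`; an affine point `R = (x, y)` of
`V mod q` (its equation as a ring identity); a `decide`-checked chain (`Rank2Observatory.chainB`, started at `R`)
reaching the multiplier `N / p` — so `(N/p) • R ≠ O`; THEN `#{P : p • P = O} ≤ p` (§1). Covers Kolyvagin primes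
with `p² ∣ N` and `Ẽ(𝔽_q)` non-cyclic (cyclic `p`-part), where the generator kit does not apply.
[cite: Hungerford1974, Ch. II §2 Exercise 2 (PDF p. 141)] [cite: SilvermanAEC2009, III.2.3] -/
theorem card_torsion_le_of_witness (hq : ¬ (q : ℤ) ∣ V.Δ) {N : ℕ}
    (hc : Nat.card (V.map (Int.castRingHom (ZMod q))).toAffine.Point = N) (hN : 0 < N) {x y : ZMod q}
    (heq : y ^ 2 + (V.a₁ : ZMod q) * x * y + (V.a₃ : ZMod q) * y =
      x ^ 3 + (V.a₂ : ZMod q) * x ^ 2 + (V.a₄ : ZMod q) * x + (V.a₆ : ZMod q))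
    (p : ℕ) (hp : p.Prime) (steps : List (Bool × ZMod q × ZMod q))
    (hmult : chainMult 1 steps = N / p) (hchain : chainB V q x y (x, y) steps = true) :
    Nat.card {P : (V.map (Int.castRingHom (ZMod q))).toAffine.Point // p • P = 0} ≤ p := by
  set G := (V.map (Int.castRingHom (ZMod q))).toAffine.Point
  haveI : Finite G := Nat.finite_of_card_ne_zero (by rw [hc]; exact hN.ne')
  have hR := nonsingular_zmod_of_eval V q hq heq
  have hne := nsmul_ne_zero_of_chainB V q hR hchain
  rw [hmult, ← hc] at hne
  exact natCard_nsmul_eq_zero_le_of_witness G hp _ hne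

/-- **The cyclicity binder of `IsCyclicKolyvaginLevel` READ OFF AN INTEGER MODEL from one witness chain**
(`integralModelInt W = E₀`): as `card_torsion_le_of_witness` on `E₀`. Companion of
`card_torsion_le_of_intModel_of_card` (`p² ∤ #Ẽ`) and `card_torsion_le_of_intModel_of_generator` (`Ẽ(𝔽_ℓ)`
cyclic). [cite: Kim2022StructureSelmer, §1.2.2] [cite: Hungerford1974, Ch. II §2 Exercise 2] -/
theorem card_torsion_le_of_intModel_of_witness {W : WeierstrassCurve ℚ} [W.IsGloballyMinimal]
    {E₀ : WeierstrassCurve ℤ} (hI : integralModelInt W = E₀) (p : ℕ) [hp : Fact p.Prime]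
    (hq : ¬ (q : ℤ) ∣ E₀.Δ) {N : ℕ} (hc : Nat.card (E₀.map (Int.castRingHom (ZMod q))).toAffine.Point = N)
    (hN : 0 < N) {x y : ZMod q}
    (heq : y ^ 2 + (E₀.a₁ : ZMod q) * x * y + (E₀.a₃ : ZMod q) * y =
      x ^ 3 + (E₀.a₂ : ZMod q) * x ^ 2 + (E₀.a₄ : ZMod q) * x + (E₀.a₆ : ZMod q))
    (steps : List (Bool × ZMod q × ZMod q))
    (hmult : chainMult 1 steps = N / p) (hchain : chainB E₀ q x y (x, y) steps = true) :
    Nat.card {P : ((WeierstrassCurve.integralModelInt W).map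
        (Int.castRingHom (ZMod q))).toAffine.Point // p • P = 0} ≤ p := by
  subst hI
  exact card_torsion_le_of_witness _ q hq hc hN heq p hp.out steps hmult hchain

end Witness

end Summit.BirchSwinnertonDyer.BirchSwinnertonDyer.Theorems.KolyvaginDepthDoor

end
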